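import Summits.Ventures.PackingBounds.Energy.TenPointCkSixGramDataY
import Summits.Ventures.PackingBounds.Energy.TenPointCkSixGramDataL
import Summits.Ventures.PackingBounds.Energy.TenPointCkSixGramDataE
import Summits.Ventures.PackingBounds.Energy.GramDataCheckFast
import HarnessLib

/-!
# The 153 × 153 SOS Gram block of `e3pt-sharp-n4N10ck6d8-rat.json`: integer PSD checks, row chunks file 3/10 (kernel evaluation)

Framing: lottery ticket; floor = certified bounds/negative ranges. Venture `PackingBounds`, cell
`pub-packcert`, energy family E3PT (pub-packcert-energy gen 15; n = 4, d = 8 kernel route = KERNEL-D6 double data route, size-split, list-route SOS bridge).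

`decide +kernel` checks, in row chunks, the integer identity `S·Y = L Lᵀ + E` with `E` symmetric (`GramData.checkRowsF`) for the data tables
`TenPointCkSixGramDataY/L/E`; collected with the diagonal dominance of `E` in `TenPointCkSixGramFacts`.
-/

namespace Summit.Ventures.PackingBounds.Energy.PentagonsSixD8

open Summit.Ventures.PackingBounds.Energy.GramData

set_option maxRecDepth 100000 in
set_option maxHeartbeats 0 in
/-- Rows 32–47 of `S·Y = L Lᵀ + E`, `E` symmetric (kernel evaluation). -/
theorem rowsW6_32_48 : checkRowsF 153 32 48 yW6 lW6 eW6 = true := by decide +kernel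

end Summit.Ventures.PackingBounds.Energy.PentagonsSixD8
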